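import Mathlib
import HarnessLib
import Literature.MathematicalPhysics.QuantumLattice.HubbardEffectiveActionCTSpinFlip
import Literature.MathematicalPhysics.QuantumLattice.GrassmannKernelAntisymmetry
import Summits.HubbardSuperconductivity.HubbardSuperconductivity.Theorems.KLProgrammeKLRegimeEngineQuarticSpinWard
import Summits.HubbardSuperconductivity.HubbardSuperconductivity.Theorems.KLProgrammeKLRegimeEngineMomentumMassConserving

/-!
# Route `KLProgramme` — K3 engine-flow child 20437 (`KLRegimeEngineV17F2`), (X).2 producer (α), route (M) strand M4 (plumbing):
# ALL SPIN/CHARGE PATTERNS of the quartic momentum kernel of `𝒱_n[K]` from the ONE pattern `(ψ̂⁺_↑, ψ̂⁻_↑, ψ̂⁺_↓, ψ̂⁻_↓)` — factor `2`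

Cell gate-hubbard-kl, seat p1b g12 (20437 registrant lineage; (α-0) memo `ALPHA0-SCOPING-MEMO.md` §3 M4 (i), KL STATUS (R59az): M4 = p1b).
Route (M) («values + per-tuple first moments ⇒ per-tuple `L¹`», memo §2) feeds k3c2-p2's near/far chain
(`fixedTupleL1_sectorisedKernel_le_near_add_far` p567419 ∘ `sum_prod_norm_mul_norm_kernel_klEffectiveAction_le` p568179) with ONE momentum datum,
the binder

  `hker : ∀ k, (∀ i, F (Ω i).1.1 (k i) ≠ 0) → ‖kernel ℂ (𝒱_n[K]) 4 (fun i => ((k i, (Ω i).1.2), (Ω i).2))‖ ≤ B`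

for EVERY label 4-tuple `Ω` (any spins `(Ω i).1.2`, any charges `(Ω i).2`), whereas the value hypothesis of (E5-F)ₙ (`IsoTupleL1AtV17F`, and child 1's
`PairArrayAtV17F` behind it) is stated at the SINGLE spin/charge pattern of `klQuarticValue … n 0 1` = `(ψ̂⁺_↑, ψ̂⁻_↑, ψ̂⁺_↓, ψ̂⁻_↓)` (Δ-spin, p1b
`…SplitSpin01`: «the engine derives the other spin patterns by `SU(2)` and spin flip INSIDE child 3»).  This file is that derivation at the level of the
plain momentum kernels, for any momentum–frequency window `A` common to the four legs:

* §1 `norm_kernel_klEffectiveAction_four_stdCharge_le_two_mul` — charges `(+,−,+,−)`, ANY spins: `‖F₄‖ ≤ 2·B` from the `(↑,↑,↓,↓)` bound `B` on `A⁴`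
  (S_z selection `kernel_klEffectiveAction_eq_zero_of_spin` kills 10 of the 16 spin patterns; `(↓,↓,↑,↑)` is the spin flip
  `kernel_hubbardEffectiveActionCT_spinFlip`; `(↑,↓,↓,↑)` / `(↓,↑,↑,↓)` are leg transpositions `norm_kernel_comp_perm`; the equal-spin patterns are the
  quartic `SU(2)` Ward identity `kernel_hubbardEffectiveActionCT_quartic_spinWard` (p3 g4) = a DIFFERENCE of two `(↑,↑,↓,↓)` values — the factor `2`);
* §2 `norm_kernel_klEffectiveAction_four_le_two_mul` — ANY charges: unbalanced strings vanish (`kernel_klEffectiveAction_eq_zero_of_charge`), balanced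
  ones are a leg permutation of `(+,−,+,−)`; label-tuple form `norm_kernel_klEffectiveAction_four_sectorLeg_le_two_mul` = the `hker` binder for every `Ω`
  of a multiplier family supported in `A`;
* §3 `sum_prod_norm_mul_norm_kernel_klEffectiveAction_four_le_of_updown` — plugged into p568179: the near-term momentum mass of EVERY label 4-tuple,
  `Σ_k (∏_i ‖F_{Ω_i}(k_i)‖)·‖F₄(k; Ω)‖ ≤ (∏_{free legs} Σ_q ‖F_{Ω_{i+1}}(q)‖)·(2B)`, from the one-pattern bound on `A⁴`.

What this file does NOT do (the other M4 items, separate files): the FREQUENCY step (values at the box frequencies from the values at the `(ω₀,ω₀,−ω₀,−ω₀)`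
pattern of `klQuarticValue` + `Λ_m`·time moment, memo §2.2) and the box ⊂ ball step (`mem_klBall_of_klIsoFamily_ne_zero`, in the tree).  Proofs only; no
definitions; nothing about the Hubbard model is asserted beyond its exact symmetries; nothing asserts any stub, K3 or superconductivity.
References: BGM 2006 §2.1 symmetries (1)–(3), §2.3 (2.25), §2.7 (2.70)–(2.71) [cite: BenfattoGiulianiMastropietro2006].
-/

noncomputable section

namespace Summit.HubbardSuperconductivity.HubbardSuperconductivity.Theorems.EngineV8

set_option linter.dupNamespace false -- summit = problem name (single-conjunct summit), D-0017

open Real Finset Literature.MathematicalPhysics.QuantumLattice Literature.Probability.LatticeModels GrassmannAlgebra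
open Summit.HubbardSuperconductivity.HubbardSuperconductivity.Theorems.KLProgrammeLegKernels
open Summit.HubbardSuperconductivity.HubbardSuperconductivity.Theorems.KLRegimeSplit
open Summit.HubbardSuperconductivity.HubbardSuperconductivity.Theorems.KLRegimeWick

variable {L M : ℕ} [NeZero L] [NeZero M]

/-! ## §1 Charges `(+,−,+,−)`, any spins -/

/-- **All spin patterns from `(↑,↑,↓,↓)`, charges `(+,−,+,−)`**: if the quartic kernel of `𝒱_n[K]` at the pattern
`(ψ̂⁺_{k₀↑}, ψ̂⁻_{k₁↑}, ψ̂⁺_{k₂↓}, ψ̂⁻_{k₃↓})` is bounded by `B` for all leg momenta–frequencies in a window `A`, then at EVERY spin assignment `s` (same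
charges, momenta in `A`) it is bounded by `2·B`: ten patterns vanish by `S_z` conservation, `(↓,↓,↑,↑)` is the spin flip, `(↑,↓,↓,↑)`, `(↓,↑,↑,↓)` are leg
transpositions, and the equal-spin patterns are the quartic `SU(2)` Ward identity (a difference of two `(↑,↑,↓,↓)` values at permuted momenta). -/
theorem norm_kernel_klEffectiveAction_four_stdCharge_le_two_mul (β U μ : ℝ) (K : TrigPolyC4v) (e₀ : ℝ) (n : ℕ)
    {A : Set (FreqMomentum L M)} {B : ℝ} (hB0 : 0 ≤ B)
    (hB : ∀ k : Fin 4 → FreqMomentum L M, (∀ i, k i ∈ A) →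
      ‖kernel ℂ (klEffectiveAction L M β U μ K e₀ n) 4 ![((k 0, 0), 0), ((k 1, 0), 1), ((k 2, 1), 0), ((k 3, 1), 1)]‖ ≤ B)
    (k : Fin 4 → FreqMomentum L M) (hk : ∀ i, k i ∈ A) (s : Fin 4 → Fin 2) :
    ‖kernel ℂ (klEffectiveAction L M β U μ K e₀ n) 4 (fun i => ((k i, s i), ![(0 : Fin 2), 1, 0, 1] i))‖ ≤ 2 * B := by
  set G := klEffectiveAction L M β U μ K e₀ n with hG
  -- spin patterns on the fixed momenta and charges
  set pat : (Fin 4 → Fin 2) → Fin 4 → HubbardFieldIdx L M := fun τ i => ((k i, τ i), ![(0 : Fin 2), 1, 0, 1] i) with hpat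
  have hP : ∀ a b c d : Fin 2, pat ![a, b, c, d] = ![((k 0, a), 0), ((k 1, b), 1), ((k 2, c), 0), ((k 3, d), 1)] := by
    intro a b c d; funext i; fin_cases i <;> rfl
  -- the three `(↑,↑,↓,↓)` values used
  have hBk : ‖kernel ℂ G 4 ![((k 0, 0), 0), ((k 1, 0), 1), ((k 2, 1), 0), ((k 3, 1), 1)]‖ ≤ B := hB k hk
  have hB13 : ‖kernel ℂ G 4 ![((k 0, 0), 0), ((k 3, 0), 1), ((k 2, 1), 0), ((k 1, 1), 1)]‖ ≤ B :=
    hB ![k 0, k 3, k 2, k 1] (fun i => by fin_cases i <;> exact hk _)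
  have hB02 : ‖kernel ℂ G 4 ![((k 2, 0), 0), ((k 1, 0), 1), ((k 0, 1), 0), ((k 3, 1), 1)]‖ ≤ B :=
    hB ![k 2, k 1, k 0, k 3] (fun i => by fin_cases i <;> exact hk _)
  -- S_z selection
  have hsel : ∀ τ : Fin 4 → Fin 2,
      (∑ i, (if (pat τ i).2 = 0 then (1 : ℤ) else -1) * (if (pat τ i).1.2 = 0 then 1 else 0)) ≠ 0 → ‖kernel ℂ G 4 (pat τ)‖ ≤ 2 * B := by
    intro τ hne
    rw [kernel_klEffectiveAction_eq_zero_of_spin β U μ K e₀ n hne, norm_zero]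
    exact mul_nonneg zero_le_two hB0
  have z0001 := hsel ![0, 0, 0, 1] (by
    simp only [hP, Fin.sum_univ_four, Fin.isValue, Matrix.cons_val_zero, Matrix.cons_val_one, Matrix.head_cons, Matrix.cons_val_two,
      Matrix.cons_val_three, Matrix.tail_cons]
    norm_num)
  have z0010 := hsel ![0, 0, 1, 0] (by
    simp only [hP, Fin.sum_univ_four, Fin.isValue, Matrix.cons_val_zero, Matrix.cons_val_one, Matrix.head_cons, Matrix.cons_val_two,
      Matrix.cons_val_three, Matrix.tail_cons]
    norm_num)
  have z0100 := hsel ![0, 1, 0, 0] (by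
    simp only [hP, Fin.sum_univ_four, Fin.isValue, Matrix.cons_val_zero, Matrix.cons_val_one, Matrix.head_cons, Matrix.cons_val_two,
      Matrix.cons_val_three, Matrix.tail_cons]
    norm_num)
  have z1000 := hsel ![1, 0, 0, 0] (by
    simp only [hP, Fin.sum_univ_four, Fin.isValue, Matrix.cons_val_zero, Matrix.cons_val_one, Matrix.head_cons, Matrix.cons_val_two,
      Matrix.cons_val_three, Matrix.tail_cons]
    norm_num)
  have z0111 := hsel ![0, 1, 1, 1] (by
    simp only [hP, Fin.sum_univ_four, Fin.isValue, Matrix.cons_val_zero, Matrix.cons_val_one, Matrix.head_cons, Matrix.cons_val_two,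
      Matrix.cons_val_three, Matrix.tail_cons]
    norm_num)
  have z1011 := hsel ![1, 0, 1, 1] (by
    simp only [hP, Fin.sum_univ_four, Fin.isValue, Matrix.cons_val_zero, Matrix.cons_val_one, Matrix.head_cons, Matrix.cons_val_two,
      Matrix.cons_val_three, Matrix.tail_cons]
    norm_num)
  have z1101 := hsel ![1, 1, 0, 1] (by
    simp only [hP, Fin.sum_univ_four, Fin.isValue, Matrix.cons_val_zero, Matrix.cons_val_one, Matrix.head_cons, Matrix.cons_val_two,
      Matrix.cons_val_three, Matrix.tail_cons]
    norm_num)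
  have z1110 := hsel ![1, 1, 1, 0] (by
    simp only [hP, Fin.sum_univ_four, Fin.isValue, Matrix.cons_val_zero, Matrix.cons_val_one, Matrix.head_cons, Matrix.cons_val_two,
      Matrix.cons_val_three, Matrix.tail_cons]
    norm_num)
  have z0101 := hsel ![0, 1, 0, 1] (by
    simp only [hP, Fin.sum_univ_four, Fin.isValue, Matrix.cons_val_zero, Matrix.cons_val_one, Matrix.head_cons, Matrix.cons_val_two,
      Matrix.cons_val_three, Matrix.tail_cons]
    norm_num)
  have z1010 := hsel ![1, 0, 1, 0] (by
    simp only [hP, Fin.sum_univ_four, Fin.isValue, Matrix.cons_val_zero, Matrix.cons_val_one, Matrix.head_cons, Matrix.cons_val_two,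
      Matrix.cons_val_three, Matrix.tail_cons]
    norm_num)
  -- spin flip
  have hflip : ∀ τ : Fin 4 → Fin 2, kernel ℂ G 4 (pat (fun i => Equiv.swap (0 : Fin 2) 1 (τ i))) = kernel ℂ G 4 (pat τ) :=
    fun τ => kernel_hubbardEffectiveActionCT_spinFlip L M β U μ K (klScale e₀ n) 4 (pat τ)
  have f1111 : kernel ℂ G 4 (pat ![1, 1, 1, 1]) = kernel ℂ G 4 (pat ![0, 0, 0, 0]) := by
    rw [← hflip]; congr 1; funext i; fin_cases i <;> rfl
  have f1100 : kernel ℂ G 4 (pat ![1, 1, 0, 0]) = kernel ℂ G 4 (pat ![0, 0, 1, 1]) := by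
    rw [← hflip]; congr 1; funext i; fin_cases i <;> rfl
  -- the six balanced patterns
  have c0011 : ‖kernel ℂ G 4 (pat ![0, 0, 1, 1])‖ ≤ 2 * B := by
    rw [hP]; linarith [hBk]
  have c1100 : ‖kernel ℂ G 4 (pat ![1, 1, 0, 0])‖ ≤ 2 * B := by
    rw [f1100]; exact c0011
  have c0110 : ‖kernel ℂ G 4 (pat ![0, 1, 1, 0])‖ ≤ 2 * B := by
    have hX : (![((k 0, 0), 0), ((k 3, 0), 1), ((k 2, 1), 0), ((k 1, 1), 1)] : Fin 4 → HubbardFieldIdx L M) ∘ (Equiv.swap (1 : Fin 4) 3) =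
        pat ![0, 1, 1, 0] := by
      funext i; fin_cases i <;> rfl
    rw [← hX, norm_kernel_comp_perm]; linarith [hB13]
  have c1001 : ‖kernel ℂ G 4 (pat ![1, 0, 0, 1])‖ ≤ 2 * B := by
    have hX : (![((k 2, 0), 0), ((k 1, 0), 1), ((k 0, 1), 0), ((k 3, 1), 1)] : Fin 4 → HubbardFieldIdx L M) ∘ (Equiv.swap (0 : Fin 4) 2) =
        pat ![1, 0, 0, 1] := by
      funext i; fin_cases i <;> rfl
    rw [← hX, norm_kernel_comp_perm]; linarith [hB02]
  have c0000 : ‖kernel ℂ G 4 (pat ![0, 0, 0, 0])‖ ≤ 2 * B := by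
    have hW : kernel ℂ G 4 ![((k 0, 0), 0), ((k 1, 0), 1), ((k 2, 0), 0), ((k 3, 0), 1)] =
        kernel ℂ G 4 ![((k 0, 0), 0), ((k 1, 0), 1), ((k 2, 1), 0), ((k 3, 1), 1)] -
          kernel ℂ G 4 ![((k 2, 0), 0), ((k 1, 0), 1), ((k 0, 1), 0), ((k 3, 1), 1)] :=
      kernel_hubbardEffectiveActionCT_quartic_spinWard L M β U μ K (klScale e₀ n) (k 0) (k 1) (k 2) (k 3)
    rw [hP, hW]
    exact (norm_sub_le _ _).trans (by linarith [hBk, hB02])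
  have c1111 : ‖kernel ℂ G 4 (pat ![1, 1, 1, 1])‖ ≤ 2 * B := by
    rw [f1111]; exact c0000
  -- case on the spins
  show ‖kernel ℂ G 4 (pat s)‖ ≤ 2 * B
  have hs : s = ![s 0, s 1, s 2, s 3] := by funext i; fin_cases i <;> rfl
  rw [hs]
  generalize s 0 = a₀; generalize s 1 = a₁; generalize s 2 = a₂; generalize s 3 = a₃
  fin_cases a₀ <;> fin_cases a₁ <;> fin_cases a₂ <;> fin_cases a₃
  all_goals try simp only [Fin.zero_eta, Fin.mk_one, Fin.isValue]
  · exact c0000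
  · exact z0001
  · exact z0010
  · exact c0011
  · exact z0100
  · exact z0101
  · exact c0110
  · exact z0111
  · exact z1000
  · exact c1001
  · exact z1010
  · exact z1011
  · exact c1100
  · exact z1101
  · exact z1110
  · exact c1111

/-! ## §2 Any charges -/

/-- **All spin AND charge patterns**: under the hypothesis of §1, the quartic kernel of `𝒱_n[K]` is `≤ 2·B` in norm at EVERY label string with leg
momenta–frequencies in `A` — strings with unbalanced charges vanish (charge conservation), balanced ones are leg permutations (antisymmetry, norm-preserving)
of the `(+,−,+,−)` order of §1. -/
theorem norm_kernel_klEffectiveAction_four_le_two_mul (β U μ : ℝ) (K : TrigPolyC4v) (e₀ : ℝ) (n : ℕ)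
    {A : Set (FreqMomentum L M)} {B : ℝ} (hB0 : 0 ≤ B)
    (hB : ∀ k : Fin 4 → FreqMomentum L M, (∀ i, k i ∈ A) →
      ‖kernel ℂ (klEffectiveAction L M β U μ K e₀ n) 4 ![((k 0, 0), 0), ((k 1, 0), 1), ((k 2, 1), 0), ((k 3, 1), 1)]‖ ≤ B)
    (X : Fin 4 → HubbardFieldIdx L M) (hX : ∀ i, (X i).1.1 ∈ A) :
    ‖kernel ℂ (klEffectiveAction L M β U μ K e₀ n) 4 X‖ ≤ 2 * B := by
  set G := klEffectiveAction L M β U μ K e₀ n with hG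
  -- the string in coordinates: momenta `k`, spins `s`, charges `c`
  set k : Fin 4 → FreqMomentum L M := fun i => (X i).1.1 with hk
  set s : Fin 4 → Fin 2 := fun i => (X i).1.2 with hs
  set c : Fin 4 → Fin 2 := fun i => (X i).2 with hc
  -- charge patterns on the fixed momenta and spins
  set pat : (Fin 4 → Fin 2) → Fin 4 → HubbardFieldIdx L M := fun γ i => ((k i, s i), γ i) with hpat
  have hXpat : X = pat c := by funext i; simp [hpat, hk, hs, hc]
  have hkA : ∀ i, k i ∈ A := hX
  -- the standard order after a leg permutation `τ`
  have hstd : ∀ τ : Equiv.Perm (Fin 4), c ∘ τ = ![0, 1, 0, 1] → ‖kernel ℂ G 4 (pat c)‖ ≤ 2 * B := by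
    intro τ hτ
    rw [← norm_kernel_comp_perm G 4 (pat c) τ]
    have hXτ : pat c ∘ τ = fun i => ((k (τ i), s (τ i)), ![(0 : Fin 2), 1, 0, 1] i) := by
      funext i
      have hi : c (τ i) = ![(0 : Fin 2), 1, 0, 1] i := congrFun hτ i
      simp only [Function.comp_apply, hpat, hi]
    rw [hXτ]
    exact norm_kernel_klEffectiveAction_four_stdCharge_le_two_mul β U μ K e₀ n hB0 hB (fun i => k (τ i)) (fun i => hkA _) (fun i => s (τ i))
  -- charge selection
  have hsel : ∀ γ : Fin 4 → Fin 2, (∑ i, (if (pat γ i).2 = 0 then (1 : ℤ) else -1)) ≠ 0 → ‖kernel ℂ G 4 (pat γ)‖ ≤ 2 * B := by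
    intro γ hne
    rw [kernel_klEffectiveAction_eq_zero_of_charge β U μ K e₀ n hne, norm_zero]
    exact mul_nonneg zero_le_two hB0
  have hPc : ∀ a b d e : Fin 2, pat ![a, b, d, e] = ![((k 0, s 0), a), ((k 1, s 1), b), ((k 2, s 2), d), ((k 3, s 3), e)] := by
    intro a b d e; funext i; fin_cases i <;> rfl
  -- case on the charges
  rw [hXpat]
  have hcv : c = ![c 0, c 1, c 2, c 3] := by funext i; fin_cases i <;> rfl
  have key : ∀ a b d e : Fin 2, c = ![a, b, d, e] → ‖kernel ℂ G 4 (pat c)‖ ≤ 2 * B := by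
    intro a b d e hce
    have unb : ∀ γ : Fin 4 → Fin 2, c = γ → (∑ i, (if (pat γ i).2 = 0 then (1 : ℤ) else -1)) ≠ 0 → ‖kernel ℂ G 4 (pat c)‖ ≤ 2 * B :=
      fun γ hγ hne => by rw [hγ]; exact hsel γ hne
    have bal : ∀ γ : Fin 4 → Fin 2, c = γ → ∀ τ : Equiv.Perm (Fin 4), γ ∘ τ = ![0, 1, 0, 1] → ‖kernel ℂ G 4 (pat c)‖ ≤ 2 * B :=
      fun γ hγ τ hτ => hstd τ (by rw [hγ]; exact hτ)
    fin_cases a <;> fin_cases b <;> fin_cases d <;> fin_cases e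
    all_goals try simp only [Fin.zero_eta, Fin.mk_one, Fin.isValue] at hce
    · exact unb _ hce (by
      simp only [hPc, Fin.sum_univ_four, Fin.isValue, Matrix.cons_val_zero, Matrix.cons_val_one, Matrix.head_cons, Matrix.cons_val_two,
        Matrix.cons_val_three, Matrix.tail_cons]
      norm_num)
    · exact unb _ hce (by
      simp only [hPc, Fin.sum_univ_four, Fin.isValue, Matrix.cons_val_zero, Matrix.cons_val_one, Matrix.head_cons, Matrix.cons_val_two,
        Matrix.cons_val_three, Matrix.tail_cons]
      norm_num)
    · exact unb _ hce (by
      simp only [hPc, Fin.sum_univ_four, Fin.isValue, Matrix.cons_val_zero, Matrix.cons_val_one, Matrix.head_cons, Matrix.cons_val_two,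
        Matrix.cons_val_three, Matrix.tail_cons]
      norm_num)
    · exact bal _ hce (Equiv.swap (1 : Fin 4) 2) (by funext i; fin_cases i <;> rfl)
    · exact unb _ hce (by
      simp only [hPc, Fin.sum_univ_four, Fin.isValue, Matrix.cons_val_zero, Matrix.cons_val_one, Matrix.head_cons, Matrix.cons_val_two,
        Matrix.cons_val_three, Matrix.tail_cons]
      norm_num)
    · exact bal _ hce (Equiv.refl _) (by funext i; fin_cases i <;> rfl)
    · exact bal _ hce (Equiv.swap (2 : Fin 4) 3) (by funext i; fin_cases i <;> rfl)
    · exact unb _ hce (by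
      simp only [hPc, Fin.sum_univ_four, Fin.isValue, Matrix.cons_val_zero, Matrix.cons_val_one, Matrix.head_cons, Matrix.cons_val_two,
        Matrix.cons_val_three, Matrix.tail_cons]
      norm_num)
    · exact unb _ hce (by
      simp only [hPc, Fin.sum_univ_four, Fin.isValue, Matrix.cons_val_zero, Matrix.cons_val_one, Matrix.head_cons, Matrix.cons_val_two,
        Matrix.cons_val_three, Matrix.tail_cons]
      norm_num)
    · exact bal _ hce (Equiv.swap (0 : Fin 4) 1) (by funext i; fin_cases i <;> rfl)
    · exact bal _ hce ((Equiv.swap (0 : Fin 4) 1) * (Equiv.swap (2 : Fin 4) 3)) (by funext i; fin_cases i <;> rfl)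
    · exact unb _ hce (by
      simp only [hPc, Fin.sum_univ_four, Fin.isValue, Matrix.cons_val_zero, Matrix.cons_val_one, Matrix.head_cons, Matrix.cons_val_two,
        Matrix.cons_val_three, Matrix.tail_cons]
      norm_num)
    · exact bal _ hce ((Equiv.swap (1 : Fin 4) 2) * ((Equiv.swap (0 : Fin 4) 1) * (Equiv.swap (2 : Fin 4) 3)))
        (by funext i; fin_cases i <;> rfl)
    · exact unb _ hce (by
      simp only [hPc, Fin.sum_univ_four, Fin.isValue, Matrix.cons_val_zero, Matrix.cons_val_one, Matrix.head_cons, Matrix.cons_val_two,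
        Matrix.cons_val_three, Matrix.tail_cons]
      norm_num)
    · exact unb _ hce (by
      simp only [hPc, Fin.sum_univ_four, Fin.isValue, Matrix.cons_val_zero, Matrix.cons_val_one, Matrix.head_cons, Matrix.cons_val_two,
        Matrix.cons_val_three, Matrix.tail_cons]
      norm_num)
    · exact unb _ hce (by
      simp only [hPc, Fin.sum_univ_four, Fin.isValue, Matrix.cons_val_zero, Matrix.cons_val_one, Matrix.head_cons, Matrix.cons_val_two,
        Matrix.cons_val_three, Matrix.tail_cons]
      norm_num)
  exact key (c 0) (c 1) (c 2) (c 3) hcv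

/-- **Label-tuple form (the `hker` binder of route (M)'s near term, for EVERY `Ω`)**: for a multiplier family `F` supported in the window `A` and the
one-pattern bound `B` on `A⁴`, every label 4-tuple `Ω` and every momentum tuple on the supports:
`‖kernel (𝒱_n[K]) 4 (k, Ω-spins, Ω-charges)‖ ≤ 2·B`. -/
theorem norm_kernel_klEffectiveAction_four_sectorLeg_le_two_mul (β U μ : ℝ) (K : TrigPolyC4v) (e₀ : ℝ) (n : ℕ) {N : ℕ}
    (F : Fin N → FreqMomentum L M → ℂ) {A : Set (FreqMomentum L M)} (hFA : ∀ ω q, F ω q ≠ 0 → q ∈ A) {B : ℝ} (hB0 : 0 ≤ B)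
    (hB : ∀ k : Fin 4 → FreqMomentum L M, (∀ i, k i ∈ A) →
      ‖kernel ℂ (klEffectiveAction L M β U μ K e₀ n) 4 ![((k 0, 0), 0), ((k 1, 0), 1), ((k 2, 1), 0), ((k 3, 1), 1)]‖ ≤ B)
    (Ω : Fin 4 → SectorLeg N) (k : Fin 4 → FreqMomentum L M) (hk : ∀ i, F (Ω i).1.1 (k i) ≠ 0) :
    ‖kernel ℂ (klEffectiveAction L M β U μ K e₀ n) 4 (fun i => ((k i, (Ω i).1.2), (Ω i).2))‖ ≤ 2 * B :=
  norm_kernel_klEffectiveAction_four_le_two_mul β U μ K e₀ n hB0 hB _ fun i => hFA _ _ (hk i)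

/-! ## §3 The near-term momentum mass of every label 4-tuple from the one-pattern bound -/

/-- **Route (M), near term, all label tuples**: for a multiplier family `F` with `‖F_ω‖ ≤ 1` supported in the window `A`, and the one-pattern bound
`‖F₄(ψ̂⁺_{k₀↑}, ψ̂⁻_{k₁↑}, ψ̂⁺_{k₂↓}, ψ̂⁻_{k₃↓})‖ ≤ B` on `A⁴`, the momentum mass read by `fixedTupleL1_sectorisedKernel_le_near_add_far` satisfies, for EVERY
label 4-tuple `Ω`, `Σ_k (∏_i ‖F_{Ω_i}(k_i)‖)·‖F₄(k; Ω)‖ ≤ (∏_{i : Fin 3} Σ_q ‖F_{Ω_{i+1}}(q)‖)·(2B)` (p568179 with `hker` := §2). -/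
theorem sum_prod_norm_mul_norm_kernel_klEffectiveAction_four_le_of_updown (β U μ : ℝ) (K : TrigPolyC4v) (e₀ : ℝ) (n : ℕ) {N : ℕ}
    (F : Fin N → FreqMomentum L M → ℂ) (hF1 : ∀ ω q, ‖F ω q‖ ≤ 1) {A : Set (FreqMomentum L M)} (hFA : ∀ ω q, F ω q ≠ 0 → q ∈ A)
    {B : ℝ} (hB0 : 0 ≤ B)
    (hB : ∀ k : Fin 4 → FreqMomentum L M, (∀ i, k i ∈ A) →
      ‖kernel ℂ (klEffectiveAction L M β U μ K e₀ n) 4 ![((k 0, 0), 0), ((k 1, 0), 1), ((k 2, 1), 0), ((k 3, 1), 1)]‖ ≤ B)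
    (Ω : Fin 4 → SectorLeg N) :
    ∑ k : Fin 4 → FreqMomentum L M, (∏ i, ‖F (Ω i).1.1 (k i)‖) *
        ‖kernel ℂ (klEffectiveAction L M β U μ K e₀ n) 4 (fun i => ((k i, (Ω i).1.2), (Ω i).2))‖ ≤
      (∏ i : Fin 3, ∑ q : FreqMomentum L M, ‖F (Ω i.succ).1.1 q‖) * (2 * B) :=
  sum_prod_norm_mul_norm_kernel_klEffectiveAction_le F hF1 β U μ K e₀ n 3 Ω (mul_nonneg zero_le_two hB0)
    (norm_kernel_klEffectiveAction_four_sectorLeg_le_two_mul β U μ K e₀ n F hFA hB0 hB Ω)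

end Summit.HubbardSuperconductivity.HubbardSuperconductivity.Theorems.EngineV8

end
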